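import Summits.QuantumFields.YangMills.Theorems.VirialFluxGapEulerDefectAlgebra
import HarnessLib

/-!
# Route `VirialFluxGap` (YangMills): THE EULER-DEFECT INEQUALITY OF THE EXPLICIT CENTRAL FIELD, TERM BY TERM — part 2: the defect telescopes and
# `D ≥ 2T − (4r + 3ρ)(3T + 4Σ‖q_j − c_j‖²)` (free-hands helper for ⟨stmt-QuantumFields-24141⟩ `PeriodicSoftness`, clause (P2) "drive ≥ 2(1−ε)F₀")

Width seat `ym-line-sfw-p2-w3` g59 (cell ym-idea-1, free hands), `--supports stmt-QuantumFields-24141`.  Continues ✓`VirialFluxGapEulerDefectAlgebra`.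

For a four-slot word `h = q₁q₂q̄₃q̄₄` of unit link quaternions with unit anchors `(c, c′, c, c′)` (parallel slots share the anchor — true for the
plaquettes `(U(x,μ), U(x+μ,ν), U(x+ν,μ), U(x,ν))` and the seam bonds `(U_last(e), S(x+k), U_0(e), S(x))` of ✓`ringPoly`), signs `σ, σ′ = ±1` and
the explicit central-field directions `A_j = Im(c̄_j q_j) + (σ_j∕2)·Im c_j`:

* §3.3 ★ `eulerDefect_decomposition` — the Euler defect `E = ḣ − (h − 1)` is, identically in the free ring, (slot cores)·(units) + (anchor-motion
  telescoping) + (anchor defect); ★★ `anchor_defect_eq` — the anchor defect is `½(σc − 1)·[c,c′]·c̄c̄′ + ½c·(σ′c′ − 1)·[c,c′]·c̄′`;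
  ★★★ `norm_eulerDefect_le` — `‖E‖ ≤ (4r + 3ρ)·(Σ_j ‖q_j − c_j‖ + ‖1 − h‖)` for `‖q_j − c_j‖ ≤ r`, `‖σc − 1‖, ‖σ′c′ − 1‖ ≤ ρ`;
* §3.4 ★★★ `euler_defect_four_le` — **`D ≥ 2T − (4r + 3ρ)·(3T + 4·Σ_j ‖q_j − c_j‖²)`**, `T = 2 − 2Re h = ‖1 − h‖²`, `D = −2Re ḣ` the term's drive
  (via ✓`drive_sub_two_eq`: `D − 2T = −2Re(E(1 − h̄)) ≥ −2‖E‖√T`).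

The proximity squares `Σ‖q_j − c_j‖²` are paid GLOBALLY by ✓`sum_norm_sq_sub_centralProj_le` (`≤ 60480·L⁸·F₀`) and `r, ρ` by the central window,
so summing over the terms of ✓`ringPoly_eq_sum_terms` gives drive `≥ 2(1 − ε_C)F₀` with `ε_C` polynomial in `L` times the window radius — NO Taylor
package, NO Hessian, NO coercivity constant beyond the two ✓central-coercivity files.  Numerics (folder `scratch/perterm_check{,2,3}.py`): the naive
ratio `D∕T` is unbounded below per term (the `Σ‖q_j − c_j‖²` correction is essential); `inf (D − 2T)∕((ρ+r)(T+Σ)) ≈ −1.2` over all anchor patterns.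

HONEST LABEL: finite-dimensional algebra; the per-term instantiation (reading the anchors off ✓`centralDir`) and the summation into (P2) are NOT here;
⟨24141⟩ and ⟨22884⟩ stay OPEN; the Yang–Mills mass gap is NOT proved by this; no summit is proved by a line.  THEOREMS ONLY (no `def`, no `sorry`).

References: [cite: CosteEtAl1985]; [cite: Luscher1983, §2].
-/

set_option autoImplicit false

noncomputable section

open scoped Quaternion

namespace Summit.QuantumFields.YangMills.Theorems.VirialFluxGap.EulerDefect

open Summit.QuantumFields.YangMills.Theorems.VirialFluxGap.CommutatorInsertion
open Summit.QuantumFields.YangMills.Theorems.VirialFluxGap.AnchorSlice (re_conj_unit)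
open Literature.MathematicalPhysics.QuantumFieldTheory.Federbush1986.SU2 (norm_im_le)
open Literature.MathematicalPhysics.QuantumFieldTheory.Balaban1983to89.T4ExpWindowSmallField (norm_sub_one_sq)
open Literature.MathematicalPhysics.QuantumFieldTheory.Balaban1983to89.T4WilsonDatumBounds (norm_mul_sub_mul_le_of_norm_eq_one
  norm_mul₃_sub_le_of_norm_eq_one)

/-! ### §3.3 The Euler defect telescopes: `‖E‖ ≤ (4r + 3ρ)(Σ_j ‖q_j − c_j‖ + ‖1 − h‖)` -/

/-- The anchor-motion commutators: `[b, c′] = (σ∕2)[c, c′]` for `b = (σ∕2)Im c`. [cite: CosteEtAl1985] -/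
theorem b_comm_eq (σ : ℝ) (c c' : ℍ) : (σ / 2) • c.im * c' - c' * ((σ / 2) • c.im) = (σ / 2) • (c * c' - c' * c) := by
  rw [smul_mul_assoc, mul_smul_comm, ← smul_sub, im_comm_eq]

/-- `[b′, c̄] = (σ′∕2)[c, c′]` for `b′ = (σ′∕2)Im c′`. [cite: CosteEtAl1985] -/
theorem b'_comm_eq (σ' : ℝ) (c c' : ℍ) : (σ' / 2) • c'.im * star c - star c * ((σ' / 2) • c'.im) = (σ' / 2) • (c * c' - c' * c) := by
  rw [smul_mul_assoc, mul_smul_comm, ← smul_sub, im_comm_eq, comm_star_left]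

/-- ★★ The ANCHOR-MOTION DEFECT at the anchors: `ḣ_b|_{q=c} − (h_tor − 1) = ½(σc − 1)·M·c̄c̄′ + ½c·(σ′c′ − 1)·M·c̄′`, `M = [c,c′]`
(uses `c·M = M·c̄`). [cite: CosteEtAl1985] -/
theorem anchor_defect_eq {c c' : ℍ} (hc : ‖c‖ = 1) (hc' : ‖c'‖ = 1) (σ σ' : ℝ) :
    c * ((σ / 2) • c.im) * c' * (star c * star c') + c * c' * ((σ' / 2) • c'.im) * (star c * star c')
        - c * c' * ((σ / 2) • c.im) * (star c * star c') - c * c' * star c * ((σ' / 2) • c'.im) * star c'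
        - (c * c' * star c * star c' - 1) =
      (1 / 2 : ℝ) • ((σ • c - 1) * (c * c' - c' * c) * (star c * star c')) + (1 / 2 : ℝ) • (c * (σ' • c' - 1) * (c * c' - c' * c) * star c') := by
  set b := (σ / 2) • c.im with hb
  set b' := (σ' / 2) • c'.im with hb'
  set M := c * c' - c' * c with hM
  have hbc : b * c' - c' * b = (σ / 2) • M := b_comm_eq σ c c'
  have hb'c : b' * star c - star c * b' = (σ' / 2) • M := b'_comm_eq σ' c c'
  have htor : c * c' * star c * star c' - 1 = M * (star c * star c') := groupComm_sub_one hc hc'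
  have hMc : M * star c = c * M := (mul_comm_eq_comm_mul_star hc c').symm
  have e1 : c * b * c' * (star c * star c') + c * c' * b' * (star c * star c') - c * c' * b * (star c * star c')
      - c * c' * star c * b' * star c' = c * (b * c' - c' * b) * (star c * star c') + c * c' * (b' * star c - star c * b') * star c' := by
    noncomm_ring
  have l1 : c * ((σ / 2) • M) * (star c * star c') = (σ / 2) • (c * M * (star c * star c')) := by rw [mul_smul_comm, smul_mul_assoc]
  have l2 : c * c' * ((σ' / 2) • M) * star c' = (σ' / 2) • (c * c' * M * star c') := by rw [mul_smul_comm, smul_mul_assoc]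
  have l3 : M * (star c * star c') = c * M * star c' := by rw [← mul_assoc, hMc]
  have r1 : (σ • c - 1) * M * (star c * star c') = σ • (c * M * (star c * star c')) - c * M * star c' := by
    rw [sub_mul, sub_mul, smul_mul_assoc, smul_mul_assoc, one_mul, l3]
  have r2 : c * (σ' • c' - 1) * M * star c' = σ' • (c * c' * M * star c') - c * M * star c' := by
    have e : c * (σ' • c' - 1) = σ' • (c * c') - c := by rw [mul_sub, mul_one, mul_smul_comm]
    rw [e, sub_mul, sub_mul, smul_mul_assoc, smul_mul_assoc]
  rw [e1, hbc, hb'c, htor, l1, l2, l3, r1, r2]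
  module

/-- ★ The DECOMPOSITION of the Euler defect `E = ḣ − (h − 1)` into slot cores, anchor-motion telescoping and the anchor defect (a free-ring
identity in twelve letters: links `q_j`, anchors `c, c′`, slot directions `y_j`, anchor directions `b, b′`). [cite: CosteEtAl1985] -/
theorem eulerDefect_decomposition (q₁ q₂ q₃ q₄ c c' y₁ y₂ y₃ y₄ b b' : ℍ) :
    (q₁ * (y₁ + b) * q₂ * star q₃ * star q₄ + q₁ * q₂ * (y₂ + b') * star q₃ * star q₄ - q₁ * q₂ * (y₃ + b) * star q₃ * star q₄ - q₁ * q₂ * star q₃ * (y₄ + b') * star q₄) - (q₁ * q₂ * star q₃ * star q₄ - 1) =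
      ((q₁ * y₁ - q₁ + c) * (q₂ * star q₃ * star q₄) + (q₁ * q₂ * y₂ - c * q₂ + c * c') * (star q₃ * star q₄) + (-((q₁ * q₂ - c * c') * y₃ * star q₃) - c * c' * (y₃ * star q₃ + star q₃ - star c)) * star q₄ + (-((q₁ * q₂ * star q₃ - c * c' * star c) * y₄ * star q₄) - c * c' * star c * (y₄ * star q₄ + star q₄ - star c')))
      + (((q₁ - c) * b * (q₂ * star q₃ * star q₄) + c * b * (q₂ * star q₃ * star q₄ - c' * star c * star c')) + ((q₁ * q₂ - c * c') * b' * (star q₃ * star q₄) + c * c' * b' * (star q₃ * star q₄ - star c * star c')) - ((q₁ * q₂ - c * c') * b * (star q₃ * star q₄) + c * c' * b * (star q₃ * star q₄ - star c * star c')) - ((q₁ * q₂ * star q₃ - c * c' * star c) * b' * star q₄ + c * c' * star c * b' * (star q₄ - star c')))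
      + (c * b * c' * (star c * star c') + c * c' * b' * (star c * star c') - c * c' * b * (star c * star c') - c * c' * star c * b' * star c' - (c * c' * star c * star c' - 1)) := by
  noncomm_ring

/-- ★★★ **The Euler defect telescopes**: `‖ḣ − (h − 1)‖ ≤ (4r + 3ρ)·(Σ_j ‖q_j − c_j‖ + ‖1 − h‖)`. [cite: CosteEtAl1985] -/
theorem norm_eulerDefect_le {q₁ q₂ q₃ q₄ c c' : ℍ} (hq₁ : ‖q₁‖ = 1) (hq₂ : ‖q₂‖ = 1) (hq₃ : ‖q₃‖ = 1) (hq₄ : ‖q₄‖ = 1)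
    (hc : ‖c‖ = 1) (hc' : ‖c'‖ = 1) {σ σ' : ℝ} (hσ : σ = 1 ∨ σ = -1) (hσ' : σ' = 1 ∨ σ' = -1) {A₁ A₂ A₃ A₄ : ℍ}
    (hA₁ : A₁ = (star c * q₁).im + (σ / 2) • c.im) (hA₂ : A₂ = (star c' * q₂).im + (σ' / 2) • c'.im)
    (hA₃ : A₃ = (star c * q₃).im + (σ / 2) • c.im) (hA₄ : A₄ = (star c' * q₄).im + (σ' / 2) • c'.im)
    {r ρ : ℝ} (hr₁ : ‖q₁ - c‖ ≤ r) (hr₂ : ‖q₂ - c'‖ ≤ r) (hr₃ : ‖q₃ - c‖ ≤ r) (hr₄ : ‖q₄ - c'‖ ≤ r)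
    (hρ : ‖σ • c - 1‖ ≤ ρ) (hρ' : ‖σ' • c' - 1‖ ≤ ρ) :
    ‖(q₁ * A₁ * q₂ * star q₃ * star q₄ + q₁ * q₂ * A₂ * star q₃ * star q₄ - q₁ * q₂ * A₃ * star q₃ * star q₄ - q₁ * q₂ * star q₃ * A₄ * star q₄) - (q₁ * q₂ * star q₃ * star q₄ - 1)‖
      ≤ (4 * r + 3 * ρ) * ((‖q₁ - c‖ + ‖q₂ - c'‖ + ‖q₃ - c‖ + ‖q₄ - c'‖) + ‖1 - q₁ * q₂ * star q₃ * star q₄‖) := by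
  subst hA₁ hA₂ hA₃ hA₄
  -- units and distances
  have hq₃' : ‖star q₃‖ = 1 := by rw [norm_star, hq₃]
  have hq₄' : ‖star q₄‖ = 1 := by rw [norm_star, hq₄]
  have hcs : ‖star c‖ = 1 := by rw [norm_star, hc]
  have hc's : ‖star c'‖ = 1 := by rw [norm_star, hc']
  have d₃' : ‖star q₃ - star c‖ = ‖q₃ - c‖ := by rw [← star_sub, norm_star]
  have d₄' : ‖star q₄ - star c'‖ = ‖q₄ - c'‖ := by rw [← star_sub, norm_star]
  have hd₁ := norm_nonneg (q₁ - c)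
  have hd₂ := norm_nonneg (q₂ - c')
  have hd₃ := norm_nonneg (q₃ - c)
  have hd₄ := norm_nonneg (q₄ - c')
  have hr : 0 ≤ r := hd₁.trans hr₁
  have hρ0 : 0 ≤ ρ := (norm_nonneg _).trans hρ
  have hN := norm_nonneg (1 - q₁ * q₂ * star q₃ * star q₄)
  -- sizes of the directions
  have hs : |σ / 2| = 1 / 2 := by rcases hσ with h1 | h1 <;> norm_num [h1]
  have hs' : |σ' / 2| = 1 / 2 := by rcases hσ' with h1 | h1 <;> norm_num [h1]
  have hbn : ‖(σ / 2) • c.im‖ ≤ ρ / 2 := by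
    rw [norm_smul, Real.norm_eq_abs, hs]; have := norm_im_le_norm_sign_sub_one hσ c; linarith
  have hb'n : ‖(σ' / 2) • c'.im‖ ≤ ρ / 2 := by
    rw [norm_smul, Real.norm_eq_abs, hs']; have := norm_im_le_norm_sign_sub_one hσ' c'; linarith
  have hb0 := norm_nonneg ((σ / 2) • c.im)
  have hb'0 := norm_nonneg ((σ' / 2) • c'.im)
  have hy₂ : ‖(star c' * q₂).im‖ ≤ ‖q₂ - c'‖ := norm_im_star_mul_le hc' q₂
  have hy₃ : ‖(star c * q₃).im‖ ≤ ‖q₃ - c‖ := norm_im_star_mul_le hc q₃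
  have hy₄ : ‖(star c' * q₄).im‖ ≤ ‖q₄ - c'‖ := norm_im_star_mul_le hc' q₄
  -- telescoping distances of partial words
  have t12 : ‖q₁ * q₂ - c * c'‖ ≤ ‖q₁ - c‖ + ‖q₂ - c'‖ := norm_mul_sub_mul_le_of_norm_eq_one hq₂ hc
  have t123 : ‖q₁ * q₂ * star q₃ - c * c' * star c‖ ≤ ‖q₁ - c‖ + ‖q₂ - c'‖ + ‖q₃ - c‖ := by
    have := norm_mul₃_sub_le_of_norm_eq_one (x := q₁) (z := star q₃) (z' := star c) hq₂ hq₃' hc hc'; rwa [d₃'] at this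
  have t234 : ‖q₂ * star q₃ * star q₄ - c' * star c * star c'‖ ≤ ‖q₂ - c'‖ + ‖q₃ - c‖ + ‖q₄ - c'‖ := by
    have := norm_mul₃_sub_le_of_norm_eq_one (x := q₂) (y := star q₃) (z := star q₄) (x' := c') (y' := star c) (z' := star c') hq₃' hq₄' hc' hcs
    rwa [d₃', d₄'] at this
  have t34 : ‖star q₃ * star q₄ - star c * star c'‖ ≤ ‖q₃ - c‖ + ‖q₄ - c'‖ := by
    have := norm_mul_sub_mul_le_of_norm_eq_one (x := star q₃) (y := star q₄) (x' := star c) (y' := star c') hq₄' hcs; rwa [d₃', d₄'] at this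
  have t4 : ‖star q₄ - star c'‖ ≤ ‖q₄ - c'‖ := d₄'.le
  have t1234 : ‖q₁ * q₂ * star q₃ * star q₄ - c * c' * star c * star c'‖ ≤ ‖q₁ - c‖ + ‖q₂ - c'‖ + ‖q₃ - c‖ + ‖q₄ - c'‖ := by
    have := norm_tel4 (x₁ := q₁) (x₂ := q₂) (x₃ := star q₃) (x₄ := star q₄) (y₁ := c) (y₂ := c') (y₃ := star c) (y₄ := star c')
      hq₂ hq₃' hq₄' hc hc' hcs
    rwa [d₃', d₄'] at this
  -- ‖E_y‖ : the four slot cores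
  have k1 : ‖(q₁ * (star c * q₁).im - q₁ + c) * (q₂ * star q₃ * star q₄)‖ ≤ 3 / 2 * ‖q₁ - c‖ ^ 2 := by
    rw [norm_mul, show ‖q₂ * star q₃ * star q₄‖ = 1 by rw [norm_mul, norm_mul, hq₂, hq₃', hq₄']; norm_num, mul_one]
    exact norm_kappa_le hc hq₁
  have k2 : ‖(q₁ * q₂ * (star c' * q₂).im - c * q₂ + c * c') * (star q₃ * star q₄)‖ ≤ ‖q₁ - c‖ * ‖q₂ - c'‖ + 3 / 2 * ‖q₂ - c'‖ ^ 2 := by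
    rw [norm_mul, show ‖star q₃ * star q₄‖ = 1 by rw [norm_mul, hq₃', hq₄']; norm_num, mul_one,
      show q₁ * q₂ * (star c' * q₂).im - c * q₂ + c * c' = (q₁ - c) * q₂ * (star c' * q₂).im + c * (q₂ * (star c' * q₂).im - q₂ + c') by noncomm_ring]
    calc ‖(q₁ - c) * q₂ * (star c' * q₂).im + c * (q₂ * (star c' * q₂).im - q₂ + c')‖
        ≤ ‖(q₁ - c) * q₂ * (star c' * q₂).im‖ + ‖c * (q₂ * (star c' * q₂).im - q₂ + c')‖ := norm_add_le _ _
      _ ≤ ‖q₁ - c‖ * ‖q₂ - c'‖ + 3 / 2 * ‖q₂ - c'‖ ^ 2 := by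
          rw [norm_mul, norm_mul, hq₂, mul_one, norm_mul, hc, one_mul]
          exact add_le_add (mul_le_mul_of_nonneg_left hy₂ hd₁) (norm_kappa_le hc' hq₂)
  have k3 : ‖(-((q₁ * q₂ - c * c') * (star c * q₃).im * star q₃) - c * c' * ((star c * q₃).im * star q₃ + star q₃ - star c)) * star q₄‖
      ≤ (‖q₁ - c‖ + ‖q₂ - c'‖) * ‖q₃ - c‖ + ‖q₃ - c‖ ^ 2 / 2 := by
    rw [norm_mul, hq₄', mul_one]
    calc ‖-((q₁ * q₂ - c * c') * (star c * q₃).im * star q₃) - c * c' * ((star c * q₃).im * star q₃ + star q₃ - star c)‖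
        ≤ ‖-((q₁ * q₂ - c * c') * (star c * q₃).im * star q₃)‖ + ‖c * c' * ((star c * q₃).im * star q₃ + star q₃ - star c)‖ := norm_sub_le _ _
      _ ≤ (‖q₁ - c‖ + ‖q₂ - c'‖) * ‖q₃ - c‖ + ‖q₃ - c‖ ^ 2 / 2 := by
          rw [norm_neg, norm_mul, norm_mul, hq₃', mul_one, norm_mul, norm_mul, hc, hc', one_mul, one_mul, norm_im_mul_star_add_eq hc hq₃]
          exact add_le_add (mul_le_mul t12 hy₃ (norm_nonneg _) (by positivity)) le_rfl
  have k4 : ‖-((q₁ * q₂ * star q₃ - c * c' * star c) * (star c' * q₄).im * star q₄) - c * c' * star c * ((star c' * q₄).im * star q₄ + star q₄ - star c')‖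
      ≤ (‖q₁ - c‖ + ‖q₂ - c'‖ + ‖q₃ - c‖) * ‖q₄ - c'‖ + ‖q₄ - c'‖ ^ 2 / 2 := by
    calc ‖-((q₁ * q₂ * star q₃ - c * c' * star c) * (star c' * q₄).im * star q₄) - c * c' * star c * ((star c' * q₄).im * star q₄ + star q₄ - star c')‖
        ≤ ‖-((q₁ * q₂ * star q₃ - c * c' * star c) * (star c' * q₄).im * star q₄)‖ + ‖c * c' * star c * ((star c' * q₄).im * star q₄ + star q₄ - star c')‖ :=
          norm_sub_le _ _
      _ ≤ (‖q₁ - c‖ + ‖q₂ - c'‖ + ‖q₃ - c‖) * ‖q₄ - c'‖ + ‖q₄ - c'‖ ^ 2 / 2 := by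
          rw [norm_neg, norm_mul, norm_mul, hq₄', mul_one, norm_mul, norm_mul, norm_mul, hc, hc', hcs, one_mul, one_mul, one_mul,
            norm_im_mul_star_add_eq hc' hq₄]
          exact add_le_add (mul_le_mul t123 hy₄ (norm_nonneg _) (by positivity)) le_rfl
  have nEy : ‖(q₁ * (star c * q₁).im - q₁ + c) * (q₂ * star q₃ * star q₄) + (q₁ * q₂ * (star c' * q₂).im - c * q₂ + c * c') * (star q₃ * star q₄) + (-((q₁ * q₂ - c * c') * (star c * q₃).im * star q₃) - c * c' * ((star c * q₃).im * star q₃ + star q₃ - star c)) * star q₄ + (-((q₁ * q₂ * star q₃ - c * c' * star c) * (star c' * q₄).im * star q₄) - c * c' * star c * ((star c' * q₄).im * star q₄ + star q₄ - star c'))‖ ≤ 4 * r * (‖q₁ - c‖ + ‖q₂ - c'‖ + ‖q₃ - c‖ + ‖q₄ - c'‖) := by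
    refine (norm_add_le _ _).trans ((add_le_add ((norm_add_le _ _).trans (add_le_add ((norm_add_le _ _).trans (add_le_add k1 k2)) k3)) k4).trans ?_)
    have p11 := mul_le_mul_of_nonneg_right hr₁ hd₁
    have p12 := mul_le_mul_of_nonneg_right hr₁ hd₂
    have p22 := mul_le_mul_of_nonneg_right hr₂ hd₂
    have p13 := mul_le_mul_of_nonneg_right hr₁ hd₃
    have p23 := mul_le_mul_of_nonneg_right hr₂ hd₃
    have p33 := mul_le_mul_of_nonneg_right hr₃ hd₃
    have p14 := mul_le_mul_of_nonneg_right hr₁ hd₄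
    have p24 := mul_le_mul_of_nonneg_right hr₂ hd₄
    have p34 := mul_le_mul_of_nonneg_right hr₃ hd₄
    have p44 := mul_le_mul_of_nonneg_right hr₄ hd₄
    have e1 := mul_nonneg hr hd₁
    have e2 := mul_nonneg hr hd₂
    have e3 := mul_nonneg hr hd₃
    have e4 := mul_nonneg hr hd₄
    rw [sq, sq, sq, sq]
    linarith
  -- ‖E_b‖ : anchor-motion telescoping
  have u234 : ‖q₂ * star q₃ * star q₄‖ = 1 := by rw [norm_mul, norm_mul, hq₂, hq₃', hq₄']; norm_num
  have u34 : ‖star q₃ * star q₄‖ = 1 := by rw [norm_mul, hq₃', hq₄']; norm_num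
  have tA : ‖(q₁ - c) * ((σ / 2) • c.im) * (q₂ * star q₃ * star q₄) + c * ((σ / 2) • c.im) * (q₂ * star q₃ * star q₄ - c' * star c * star c')‖
      ≤ ‖(σ / 2) • c.im‖ * (‖q₁ - c‖ + ‖q₂ - c'‖ + ‖q₃ - c‖ + ‖q₄ - c'‖) := by
    refine (norm_add_le _ _).trans ?_
    rw [norm_mul, norm_mul, u234, mul_one, norm_mul, norm_mul, hc, one_mul]
    have := mul_le_mul_of_nonneg_left t234 hb0
    linarith
  have tB : ‖(q₁ * q₂ - c * c') * ((σ' / 2) • c'.im) * (star q₃ * star q₄) + c * c' * ((σ' / 2) • c'.im) * (star q₃ * star q₄ - star c * star c')‖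
      ≤ ‖(σ' / 2) • c'.im‖ * (‖q₁ - c‖ + ‖q₂ - c'‖ + ‖q₃ - c‖ + ‖q₄ - c'‖) := by
    refine (norm_add_le _ _).trans ?_
    rw [norm_mul, norm_mul, u34, mul_one, norm_mul, norm_mul, norm_mul, hc, hc', one_mul, one_mul]
    have := mul_le_mul_of_nonneg_left t34 hb'0
    have := mul_le_mul_of_nonneg_right t12 hb'0
    linarith
  have tC : ‖(q₁ * q₂ - c * c') * ((σ / 2) • c.im) * (star q₃ * star q₄) + c * c' * ((σ / 2) • c.im) * (star q₃ * star q₄ - star c * star c')‖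
      ≤ ‖(σ / 2) • c.im‖ * (‖q₁ - c‖ + ‖q₂ - c'‖ + ‖q₃ - c‖ + ‖q₄ - c'‖) := by
    refine (norm_add_le _ _).trans ?_
    rw [norm_mul, norm_mul, u34, mul_one, norm_mul, norm_mul, norm_mul, hc, hc', one_mul, one_mul]
    have := mul_le_mul_of_nonneg_left t34 hb0
    have := mul_le_mul_of_nonneg_right t12 hb0
    linarith
  have tD : ‖(q₁ * q₂ * star q₃ - c * c' * star c) * ((σ' / 2) • c'.im) * star q₄ + c * c' * star c * ((σ' / 2) • c'.im) * (star q₄ - star c')‖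
      ≤ ‖(σ' / 2) • c'.im‖ * (‖q₁ - c‖ + ‖q₂ - c'‖ + ‖q₃ - c‖ + ‖q₄ - c'‖) := by
    refine (norm_add_le _ _).trans ?_
    rw [norm_mul, norm_mul, hq₄', mul_one, norm_mul, norm_mul, norm_mul, norm_mul, hc, hc', hcs, one_mul, one_mul, one_mul]
    have := mul_le_mul_of_nonneg_left t4 hb'0
    have := mul_le_mul_of_nonneg_right t123 hb'0
    linarith
  have nEb : ‖(((q₁ - c) * ((σ / 2) • c.im) * (q₂ * star q₃ * star q₄) + c * ((σ / 2) • c.im) * (q₂ * star q₃ * star q₄ - c' * star c * star c')) + ((q₁ * q₂ - c * c') * ((σ' / 2) • c'.im) * (star q₃ * star q₄) + c * c' * ((σ' / 2) • c'.im) * (star q₃ * star q₄ - star c * star c')) - ((q₁ * q₂ - c * c') * ((σ / 2) • c.im) * (star q₃ * star q₄) + c * c' * ((σ / 2) • c.im) * (star q₃ * star q₄ - star c * star c')) - ((q₁ * q₂ * star q₃ - c * c' * star c) * ((σ' / 2) • c'.im) * star q₄ + c * c' * star c * ((σ' / 2) • c'.im) * (star q₄ - star c')))‖ ≤ 2 *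 ρ * (‖q₁ - c‖ + ‖q₂ - c'‖ + ‖q₃ - c‖ + ‖q₄ - c'‖) := by
    refine (norm_sub_le _ _).trans ((add_le_add ((norm_sub_le _ _).trans (add_le_add ((norm_add_le _ _).trans (add_le_add tA tB)) tC)) tD).trans ?_)
    have hS : 0 ≤ ‖q₁ - c‖ + ‖q₂ - c'‖ + ‖q₃ - c‖ + ‖q₄ - c'‖ := by positivity
    have := mul_le_mul_of_nonneg_right hbn hS
    have := mul_le_mul_of_nonneg_right hb'n hS
    linarith
  -- ‖E_b¹ − (h_tor − 1)‖ : the anchor defect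
  have hM : ‖c * c' - c' * c‖ ≤ ‖1 - q₁ * q₂ * star q₃ * star q₄‖ + (‖q₁ - c‖ + ‖q₂ - c'‖ + ‖q₃ - c‖ + ‖q₄ - c'‖) := by
    have e : c * c' - c' * c = (c * c' - c' * c) * (star c * star c') * (c' * c) := by
      rw [show (c * c' - c' * c) * (star c * star c') * (c' * c) = (c * c' - c' * c) * (star c * ((star c' * c') * c)) by noncomm_ring,
        (mul_star_self_of_norm hc').2, one_mul, (mul_star_self_of_norm hc).2, mul_one]
    rw [e, norm_mul, show ‖c' * c‖ = 1 by rw [norm_mul, hc, hc', mul_one], mul_one, ← groupComm_sub_one hc hc',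
      show c * c' * star c * star c' - 1 = (q₁ * q₂ * star q₃ * star q₄ - 1) - (q₁ * q₂ * star q₃ * star q₄ - c * c' * star c * star c') by abel]
    exact (norm_sub_le _ _).trans (add_le_add (by rw [← norm_neg, neg_sub]) t1234)
  have nEb1 : ‖(c * ((σ / 2) • c.im) * c' * (star c * star c') + c * c' * ((σ' / 2) • c'.im) * (star c * star c') - c * c' * ((σ / 2) • c.im) * (star c * star c') - c * c' * star c * ((σ' / 2) • c'.im) * star c' - (c * c' * star c * star c' - 1))‖ ≤ ρ * (‖1 - q₁ * q₂ * star q₃ * star q₄‖ + (‖q₁ - c‖ + ‖q₂ - c'‖ + ‖q₃ - c‖ + ‖q₄ - c'‖)) := by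
    rw [anchor_defect_eq hc hc' σ σ']
    refine (norm_add_le _ _).trans ?_
    rw [norm_smul, norm_smul, Real.norm_eq_abs, abs_of_pos (by norm_num : (0:ℝ) < 1 / 2), norm_mul, norm_mul,
      show ‖star c * star c'‖ = 1 by rw [norm_mul, hcs, hc's, mul_one], mul_one, norm_mul, norm_mul, norm_mul, hc, hc's, one_mul, mul_one]
    have hMn := norm_nonneg (c * c' - c' * c)
    have := mul_le_mul hρ hM hMn hρ0
    have := mul_le_mul hρ' hM hMn hρ0
    linarith
  -- assemble
  rw [eulerDefect_decomposition q₁ q₂ q₃ q₄ c c' ((star c * q₁).im) ((star c' * q₂).im) ((star c * q₃).im) ((star c' * q₄).im) (((σ / 2) • c.im)) (((σ' / 2) • c'.im))]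
  refine (norm_add_le _ _).trans ((add_le_add ((norm_add_le _ _).trans (add_le_add nEy nEb)) nEb1).trans ?_)
  have := mul_nonneg hr hN
  have := mul_nonneg hρ0 hN
  linarith

/-! ### §3.4 The Euler-defect inequality -/

/-- ★★★ **THE EULER-DEFECT INEQUALITY OF A FOUR-SLOT WORD.**  For unit link quaternions `q₁, …, q₄` with unit anchors `(c, c′, c, c′)`
(parallel slots share the anchor), signs `σ, σ′ = ±1`, the central-field directions `A_j = Im(c̄_j q_j) + (σ_j∕2)·Im c_j`, proximity
`‖q_j − c_j‖ ≤ r` and anchor size `‖σc − 1‖, ‖σ′c′ − 1‖ ≤ ρ`, the drive `D = −2Re(q₁A₁q₂q̄₃q̄₄ + q₁q₂A₂q̄₃q̄₄ − q₁q₂A₃q̄₃q̄₄ − q₁q₂q̄₃A₄q̄₄)`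
of the word `T = 2 − 2Re(q₁q₂q̄₃q̄₄)` satisfies
  `D ≥ 2T − (4r + 3ρ)·(3T + 4·Σ_j ‖q_j − c_j‖²)`.
(Plaquettes: `(q₁,q₂,q₃,q₄) = (U(x,μ), U(x+μ,ν), U(x+ν,μ), U(x,ν))`; seam bonds: `(U_last(e), S(x+k), U_0(e), S(x))`; the proximity squares are
paid globally by ✓`sum_norm_sq_sub_centralProj_le`, the anchor size by the central window.) [cite: CosteEtAl1985] -/
theorem euler_defect_four_le {q₁ q₂ q₃ q₄ c c' : ℍ} (hq₁ : ‖q₁‖ = 1) (hq₂ : ‖q₂‖ = 1) (hq₃ : ‖q₃‖ = 1) (hq₄ : ‖q₄‖ = 1)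
    (hc : ‖c‖ = 1) (hc' : ‖c'‖ = 1) {σ σ' : ℝ} (hσ : σ = 1 ∨ σ = -1) (hσ' : σ' = 1 ∨ σ' = -1) {A₁ A₂ A₃ A₄ : ℍ}
    (hA₁ : A₁ = (star c * q₁).im + (σ / 2) • c.im) (hA₂ : A₂ = (star c' * q₂).im + (σ' / 2) • c'.im)
    (hA₃ : A₃ = (star c * q₃).im + (σ / 2) • c.im) (hA₄ : A₄ = (star c' * q₄).im + (σ' / 2) • c'.im)
    {r ρ : ℝ} (hr₁ : ‖q₁ - c‖ ≤ r) (hr₂ : ‖q₂ - c'‖ ≤ r) (hr₃ : ‖q₃ - c‖ ≤ r) (hr₄ : ‖q₄ - c'‖ ≤ r)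
    (hρ : ‖σ • c - 1‖ ≤ ρ) (hρ' : ‖σ' • c' - 1‖ ≤ ρ) :
    2 * (2 - 2 * (q₁ * q₂ * star q₃ * star q₄).re)
        - (4 * r + 3 * ρ) * (3 * (2 - 2 * (q₁ * q₂ * star q₃ * star q₄).re) + 4 * (‖q₁ - c‖ ^ 2 + ‖q₂ - c'‖ ^ 2 + ‖q₃ - c‖ ^ 2 + ‖q₄ - c'‖ ^ 2))
      ≤ -2 * (q₁ * A₁ * q₂ * star q₃ * star q₄ + q₁ * q₂ * A₂ * star q₃ * star q₄ - q₁ * q₂ * A₃ * star q₃ * star q₄ - q₁ * q₂ * star q₃ * A₄ * star q₄).re := by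
  have hS2 : ∀ a b c d : ℝ, (a + b + c + d) ^ 2 ≤ 4 * (a ^ 2 + b ^ 2 + c ^ 2 + d ^ 2) := fun a b c d => by
    nlinarith [sq_nonneg (a - b), sq_nonneg (a - c), sq_nonneg (a - d), sq_nonneg (b - c), sq_nonneg (b - d), sq_nonneg (c - d)]
  have hre₁ : A₁.re = 0 := by rw [hA₁]; simp
  have hre₂ : A₂.re = 0 := by rw [hA₂]; simp
  have hre₃ : A₃.re = 0 := by rw [hA₃]; simp
  have hre₄ : A₄.re = 0 := by rw [hA₄]; simp
  have hD := drive_sub_two_eq hq₁ hq₂ hq₃ hq₄ hre₁ hre₂ hre₃ hre₄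
  have hE := norm_eulerDefect_le hq₁ hq₂ hq₃ hq₄ hc hc' hσ hσ' hA₁ hA₂ hA₃ hA₄ hr₁ hr₂ hr₃ hr₄ hρ hρ'
  have hu : ‖q₁ * q₂ * star q₃ * star q₄‖ = 1 := by rw [norm_mul, norm_mul, norm_mul, norm_star, norm_star, hq₁, hq₂, hq₃, hq₄]; norm_num
  have hN2 : ‖1 - q₁ * q₂ * star q₃ * star q₄‖ ^ 2 = 2 - 2 * (q₁ * q₂ * star q₃ * star q₄).re := norm_one_sub_sq hu
  have hstar : ‖1 - star (q₁ * q₂ * star q₃ * star q₄)‖ = ‖1 - q₁ * q₂ * star q₃ * star q₄‖ := by rw [← star_one ℍ, ← star_sub, norm_star, star_one]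
  have hX : |(((q₁ * A₁ * q₂ * star q₃ * star q₄ + q₁ * q₂ * A₂ * star q₃ * star q₄ - q₁ * q₂ * A₃ * star q₃ * star q₄ - q₁ * q₂ * star q₃ * A₄ * star q₄) - (q₁ * q₂ * star q₃ * star q₄ - 1)) * (1 - star (q₁ * q₂ * star q₃ * star q₄))).re|
      ≤ ‖(q₁ * A₁ * q₂ * star q₃ * star q₄ + q₁ * q₂ * A₂ * star q₃ * star q₄ - q₁ * q₂ * A₃ * star q₃ * star q₄ - q₁ * q₂ * star q₃ * A₄ * star q₄) - (q₁ * q₂ * star q₃ * star q₄ - 1)‖ * ‖1 - q₁ * q₂ * star q₃ * star q₄‖ := by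
    rw [← hstar, ← norm_mul]
    exact Literature.MathematicalPhysics.QuantumLattice.abs_re_le_norm _
  -- real bookkeeping
  set T := 2 - 2 * (q₁ * q₂ * star q₃ * star q₄).re with hT
  set N := ‖1 - q₁ * q₂ * star q₃ * star q₄‖ with hN
  set S := ‖q₁ - c‖ + ‖q₂ - c'‖ + ‖q₃ - c‖ + ‖q₄ - c'‖ with hS
  set K := 4 * r + 3 * ρ with hK
  have hr : 0 ≤ r := (norm_nonneg _).trans hr₁
  have hρ0 : 0 ≤ ρ := (norm_nonneg _).trans hρ
  have hK0 : 0 ≤ K := by rw [hK]; positivity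
  have hN0 : 0 ≤ N := norm_nonneg _
  have hS2 : S ^ 2 ≤ 4 * (‖q₁ - c‖ ^ 2 + ‖q₂ - c'‖ ^ 2 + ‖q₃ - c‖ ^ 2 + ‖q₄ - c'‖ ^ 2) := hS2 _ _ _ _
  have hAM : 2 * S * N ≤ S ^ 2 + N ^ 2 := two_mul_le_add_sq S N
  have hEN := mul_le_mul_of_nonneg_right hE hN0
  have m1 := mul_le_mul_of_nonneg_left hAM hK0
  have m2 := mul_le_mul_of_nonneg_left hS2 hK0
  have m3 : K * N ^ 2 = K * T := by rw [hN2]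
  have hXle := (abs_le.mp hX).2
  linarith [hEN, m1, m2, m3, hXle, hD]

end Summit.QuantumFields.YangMills.Theorems.VirialFluxGap.EulerDefect

end
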